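import Summits.AtomisticToContinuum.Crystallization.Theses.NashClassCertificates

/-!
# Crux `NashTwoShellGap` (stmt-AtomisticToContinuum-16826), line `bulk_dilute`, stub `stub_badPhaseOfTorusGap`:
# the bulk bad-phase gap is below the two-shell gap on the torus

Kernel-checked bookkeeping for line `bulk_dilute` (`Cruxes/NashTwoShellGap/Lines/bulk_dilute.lean`).
The line's bulk stub `stub_badPhaseGap` asks, for every density `β₀ > 0`, for a FLAT gap `γ > 0`:
every periodic configuration `P` of `ℝ³` with `1/3`-separated point set and at least `β₀ · #motif`
motif points that are `1/20`-bad in `P.points` has `e* + γ ≤ e(P)`, `e* = ⨅_Q e(Q)`.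

This file records that it is a consequence of the TWO-SHELL GAP ON THE TORUS at tolerance `1/20`
(the hypothesis of `NashTwoShellGapReductions.nashTwoShellGap_of_torusTwoShellGap`, the residual
core of the sister crux stmt-13956):

  `∃ g > 0, ∀ P, P.points 1/3-separated → e* + g · #bad(motif) / #motif ≤ e(P)`.

Proof: `γ := g · β₀`; since `#motif > 0` (`P.motif_nonempty`), `β₀ · #motif ≤ #bad(motif)` gives
`β₀ ≤ #bad(motif) / #motif`, hence `e* + g β₀ ≤ e* + g · #bad(motif) / #motif ≤ e(P)`.
The converse direction is NOT claimed (the flat gap carries no rate as `β₀ → 0`).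
No definitions; all `[folklore]`.
-/

noncomputable section

namespace Summit.AtomisticToContinuum.Crystallization.Theorems.NashTwoShellGapBadPhaseOfTorusGap

open scoped BigOperators Classical
open Literature.MathematicalPhysics.StatisticalMechanics Literature.Geometry.DiscreteGeometry

/-- **Bad-phase gap ⇐ torus two-shell gap** (hypothesis form; `γ := g · β₀`): a linear price
`g` per unit of bad motif FRACTION gives the flat gap `g β₀` on the class of periodic
configurations with bad motif fraction `≥ β₀`. [folklore] -/
theorem badPhaseGap_of_torusTwoShellGap
    (h : ∃ g : ℝ, 0 < g ∧ ∀ P : PeriodicConfiguration 3,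
      (∀ u ∈ P.points, ∀ v ∈ P.points, u ≠ v → (1 / 3 : ℝ) ≤ dist u v) →
      (⨅ Q : PeriodicConfiguration 3, Q.energyPerParticle lennardJones)
        + g * ((P.motif.filter fun y => ¬ IsTwoShellGoodSet (1 / 20) (47 / 50) 1 P.points y).card : ℝ)
            / (P.motif.card : ℝ)
        ≤ P.energyPerParticle lennardJones)
    (β₀ : ℝ) (hβ₀ : 0 < β₀) :
    ∃ γ : ℝ, 0 < γ ∧ ∀ P : PeriodicConfiguration 3,
      (∀ u ∈ P.points, ∀ v ∈ P.points, u ≠ v → (1 / 3 : ℝ) ≤ dist u v) →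
      β₀ * (P.motif.card : ℝ)
        ≤ ((P.motif.filter fun y => ¬ IsTwoShellGoodSet (1 / 20) (47 / 50) 1 P.points y).card : ℝ) →
      (⨅ Q : PeriodicConfiguration 3, Q.energyPerParticle lennardJones) + γ
        ≤ P.energyPerParticle lennardJones := by
  obtain ⟨g, hg, hG⟩ := h
  refine ⟨g * β₀, mul_pos hg hβ₀, fun P hsep hfrac => ?_⟩
  have key := hG P hsep
  have hm : (0 : ℝ) < (P.motif.card : ℝ) := by
    exact_mod_cast Finset.card_pos.2 P.motif_nonempty
  have hβ : β₀ ≤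
      ((P.motif.filter fun y => ¬ IsTwoShellGoodSet (1 / 20) (47 / 50) 1 P.points y).card : ℝ)
        / (P.motif.card : ℝ) := by
    rw [le_div_iff₀ hm]
    exact hfrac
  have hmul : g * β₀ ≤
      g * ((P.motif.filter fun y => ¬ IsTwoShellGoodSet (1 / 20) (47 / 50) 1 P.points y).card : ℝ)
        / (P.motif.card : ℝ) := by
    rw [mul_div_assoc]
    exact mul_le_mul_of_nonneg_left hβ hg.le
  linarith [key, hmul]

/-- **Registered sub-goal `stub_badPhaseOfTorusGap`** (line `bulk_dilute`; bookkeeping, not part of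
the composition `NashTwoShellGap_of`): the two-shell gap on the torus at tolerance `1/20` implies
the line's bulk stub `stub_badPhaseGap` with `γ := g · β₀` (`#motif > 0`). [folklore] -/
theorem stub_badPhaseOfTorusGap : (∃ g : ℝ, 0 < g ∧ ∀ P : Literature.MathematicalPhysics.StatisticalMechanics.PeriodicConfiguration 3, (∀ u ∈ P.points, ∀ v ∈ P.points, u ≠ v → (1 / 3 : ℝ) ≤ dist u v) → (⨅ Q : Literature.MathematicalPhysics.StatisticalMechanics.PeriodicConfiguration 3, Q.energyPerParticle Literature.MathematicalPhysics.StatisticalMechanics.lennardJones) + g * ((P.motif.filter fun y => ¬ Literature.Geometry.DiscreteGeometry.IsTwoShellGoodSet (1 / 20) (47 / 50) 1 P.points y).card : ℝ) / (P.motif.card : ℝ) ≤ P.energyPerParticle Literature.MathematicalPhysics.StatisticalMechanics.lennardJones) → ∀ β₀ : ℝ, 0 < β₀ → ∃ γ : ℝ, 0 < γ ∧ ∀ P : Literature.MathematicalPhysics.StatisticalMechanics.PeriodicConfiguration 3, (∀ u ∈ P.points, ∀ v ∈ P.points, u ≠ v → (1 / 3 : ℝ) ≤ dist u v) → β₀ *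 (P.motif.card : ℝ) ≤ ((P.motif.filter fun y => ¬ Literature.Geometry.DiscreteGeometry.IsTwoShellGoodSet (1 / 20) (47 / 50) 1 P.points y).card : ℝ) → (⨅ Q : Literature.MathematicalPhysics.StatisticalMechanics.PeriodicConfiguration 3, Q.energyPerParticle Literature.MathematicalPhysics.StatisticalMechanics.lennardJones) + γ ≤ P.energyPerParticle Literature.MathematicalPhysics.StatisticalMechanics.lennardJones :=
  badPhaseGap_of_torusTwoShellGap

end Summit.AtomisticToContinuum.Crystallization.Theorems.NashTwoShellGapBadPhaseOfTorusGap

end
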